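import Literature.Probability.LatticeModels.KilledWalkHubFactorisation
import Literature.Probability.LatticeModels.BoxDirichlet
import HarnessLib

/-!
# Hitting probabilities are transported by lattice motions (line `symplectic-fermion-anchor`,
crux `SAWLoopFugacityFlow.AvoidanceLimit`, stmt-CriticalPhenomena-10649)

Brick B1 of the shield lemma: a maneuver estimate proved in one lattice orientation is moved to
the other orientations by a symmetry `σ` of `ℤ²`. Here `σ : Site 2 ≃ Site 2` is a bijective
**lattice motion** (`IsLatticeMotion σ`, `BoxDirichlet.lean`: `σ (x + e_k) = σ x + e_{perm k}` for a
fixed permutation `perm` of the four directions), the edge-killed walk along the subgraph `Gr` is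
pushed forward to the walk along `Gr.map σ` (`SimpleGraph.map`), and the killed hitting probability
`hitProb Gr Λ B = killedHarmExt Gr (Λ ∖ B) 𝟙_B` (`KilledWalkHubFactorisation.lean`) satisfies

  `hitProb (Gr.map σ) (σ '' Λ) (σ '' B) (σ x) = hitProb Gr Λ B x`.

Proof (no random walks): the sub-Markov neighbour average of the killed walk commutes with `σ`
(`killedAvg_map_equiv`: reindex the four directions by `perm`, `SimpleGraph.map_adj_apply`), so
`y ↦ hitProb Gr Λ B (σ⁻¹ y)` is killed-harmonic for `Gr.map σ` on `σ '' Λ ∖ σ '' B = σ '' (Λ ∖ B)`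
with exterior values `𝟙_{σ '' B}`; uniqueness for the Dirichlet problem of the killed walk on a
finite set (`IsKilledHarmonicOn.eq_killedHarmExt`, `KilledWalkLaplacian.lean`) identifies it with
`hitProb (Gr.map σ) (σ '' Λ) (σ '' B)`. Source for the setting: D. Chelkak, *Robust discrete complex
analysis: a toolbox*, Ann. Probab. 44 (2016), §2.3, §3.1 [Chelkak2016]; G. F. Lawler, V. Limic,
*Random Walk: A Modern Introduction* (2010), §6.1 [LawlerLimic2010].
-/

noncomputable section

open scoped BigOperators Classical
open Set SimpleGraph Literature.Probability.LatticeModels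

namespace Summit.CriticalPhenomena.SAWScalingLimit.Theorems.AvoidanceLimit.Anchor

/-- The killed neighbour average as a sum over the four `cornerUnit` directions:
`killedAvg Gr h v = ¼ ∑_{k : Fin 4} [Gr.Adj v (v + e_k)] h (v + e_k)`. [folklore] -/
theorem killedAvg_eq_sum_cornerUnit (Gr : SimpleGraph (Site 2)) (h : Site 2 → ℝ) (v : Site 2) :
    killedAvg Gr h v = 4⁻¹ * ∑ k : Fin 4, if Gr.Adj v (v + cornerUnit k) then h (v + cornerUnit k) else 0 := by
  rw [killedAvg_def, sum_dir_eq_sum_cornerUnit (fun w => if Gr.Adj v (v + w) then h (v + w) else 0)]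

/-- Adjacency in the pushed-forward graph: `(Gr.map σ).Adj (σ a) (σ b) ↔ Gr.Adj a b` for a
bijection `σ`. [folklore] -/
theorem map_equiv_adj_iff (Gr : SimpleGraph (Site 2)) (σ : Site 2 ≃ Site 2) (a b : Site 2) :
    (Gr.map σ.toEmbedding).Adj (σ a) (σ b) ↔ Gr.Adj a b :=
  SimpleGraph.map_adj_apply (G := Gr) (f := σ.toEmbedding) (a := a) (b := b)

/-- **The killed neighbour average commutes with lattice motions.** For a bijective lattice motion
`σ` and any `h`, the `Gr.map σ`-killed average of `h ∘ σ⁻¹` at `σ v` is the `Gr`-killed average of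
`h` at `v`: the four lattice neighbours `σ v + e_k` of `σ v` are the images `σ (v + e_{perm⁻¹ k})`,
the `Gr.map σ`-edges at `σ v` are the images of the `Gr`-edges at `v`, and the sum over the four
directions is reindexed by `perm`. [folklore] -/
theorem killedAvg_map_equiv {σ : Site 2 ≃ Site 2} (hσ : IsLatticeMotion σ) (Gr : SimpleGraph (Site 2))
    (h : Site 2 → ℝ) (v : Site 2) :
    killedAvg (Gr.map σ.toEmbedding) (fun y => h (σ.symm y)) (σ v) = killedAvg Gr h v := by
  obtain ⟨perm, hperm⟩ := hσ
  rw [killedAvg_eq_sum_cornerUnit, killedAvg_eq_sum_cornerUnit]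
  congr 1
  symm
  refine Fintype.sum_equiv perm _ _ fun k => ?_
  rw [← hperm v k]
  simp only [Equiv.symm_apply_apply, map_equiv_adj_iff]

/-- **Hitting probabilities are transported by lattice motions.** Let `σ : ℤ² ≃ ℤ²` be a lattice
motion, `Gr` a subgraph of `ℤ²`, `Λ` finite and `B` arbitrary. Then for every `x`,
`hitProb (Gr.map σ) (σ '' Λ) (σ '' B) (σ x) = hitProb Gr Λ B x`. Proof: put `S := Λ ∖ B`,
`S' := σ '' Λ ∖ σ '' B = σ '' S` (finite) and `h' := hitProb Gr Λ B ∘ σ⁻¹`. Off `S'`, `h'` is the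
indicator of `σ '' B` (`hitProb_of_not_mem`, `y ∈ σ '' B ↔ σ⁻¹ y ∈ B`); on `S'`, `h'` is
killed-harmonic for `Gr.map σ` (`hitProb_harmonicOn` and `killedAvg_map_equiv`). By uniqueness of the
killed-harmonic extension (`IsKilledHarmonicOn.eq_killedHarmExt`) `h'` is
`hitProb (Gr.map σ) (σ '' Λ) (σ '' B)` on `S'`, and off `S'` both are the indicator; evaluate at
`σ x`. [cite: Chelkak2016, §2.3] -/
theorem hitProb_map_equiv :
    ∀ (σ : Site 2 ≃ Site 2), IsLatticeMotion σ → ∀ (Gr : SimpleGraph (Site 2)) (Λ B : Set (Site 2)), Λ.Finite →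
      ∀ x : Site 2, hitProb (Gr.map σ.toEmbedding) (σ '' Λ) (σ '' B) (σ x) = hitProb Gr Λ B x := by
  intro σ hσ Gr Λ B hΛ x
  -- the transported region
  have hS' : σ '' Λ \ σ '' B = σ '' (Λ \ B) := (Set.image_sdiff σ.injective Λ B).symm
  have hS'fin : (σ '' Λ \ σ '' B).Finite := (hΛ.image σ).subset fun _ hz => hz.1
  -- exterior values of `hitProb Gr Λ B ∘ σ⁻¹`
  have hoff : ∀ y ∉ σ '' Λ \ σ '' B,
      hitProb Gr Λ B (σ.symm y) = if y ∈ σ '' B then (1 : ℝ) else 0 := by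
    intro y hy
    have hy' : σ.symm y ∉ Λ \ B := fun hmem =>
      hy (by rw [hS']; exact ⟨σ.symm y, hmem, σ.apply_symm_apply y⟩)
    rw [hitProb_of_not_mem hy', Set.mem_image_equiv]
  -- `hitProb Gr Λ B ∘ σ⁻¹` is killed-harmonic for the pushed-forward walk on the transported region
  have hharm : IsKilledHarmonicOn (Gr.map σ.toEmbedding) (fun y => hitProb Gr Λ B (σ.symm y))
      (σ '' Λ \ σ '' B) := by
    intro y hy
    rw [hS'] at hy
    obtain ⟨v, hv, rfl⟩ := hy
    rw [killedAvg_map_equiv hσ Gr (hitProb Gr Λ B) v]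
    simp only [Equiv.symm_apply_apply]
    exact hitProb_harmonicOn hΛ v hv
  by_cases hx : x ∈ Λ \ B
  · have hmem : σ x ∈ σ '' Λ \ σ '' B := by rw [hS']; exact Set.mem_image_of_mem σ hx
    have key := hharm.eq_killedHarmExt hS'fin (g := fun w => if w ∈ σ '' B then (1 : ℝ) else 0)
      (fun w hw => hoff w hw.1) (σ x) hmem
    calc hitProb (Gr.map σ.toEmbedding) (σ '' Λ) (σ '' B) (σ x)
        = killedHarmExt (Gr.map σ.toEmbedding) (σ '' Λ \ σ '' B)
            (fun w => if w ∈ σ '' B then (1 : ℝ) else 0) (σ x) := rfl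
      _ = hitProb Gr Λ B (σ.symm (σ x)) := key.symm
      _ = hitProb Gr Λ B x := by rw [Equiv.symm_apply_apply]
  · have hx' : σ x ∉ σ '' Λ \ σ '' B := by
      rw [hS']; exact fun hmem => hx (σ.injective.mem_set_image.1 hmem)
    rw [hitProb_of_not_mem hx', hitProb_of_not_mem hx, σ.injective.mem_set_image]

end Summit.CriticalPhenomena.SAWScalingLimit.Theorems.AvoidanceLimit.Anchor

end
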